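import Literature.NumberTheory.EllipticCurves.QuadraticTwistKodairaSymbolProofs
import Literature.NumberTheory.DiophantineGeometry.TateAlgorithmIstarEvalProofs
import Literature.NumberTheory.DiophantineGeometry.Conductor
import HarnessLib

/-!
# Minimality, minimal discriminant, Kodaira symbol and conductor exponent under an unramified
# quadratic twist

`Proofs` file (theorems only, no definitions, no named facts) in topic
`NumberTheory/EllipticCurves`, sequel of `QuadraticTwistKodairaSymbolProofs`.

Let `R` be a DVR with fraction field `K` and `k ∈ R` with `d = 4k + 1 ∈ Rˣ` (an *unramified*
twisting parameter: `d` is a `v`-adic unit, `≡ 1 (mod 4)` when the residue characteristic is `2`).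
For a Weierstrass equation `X / K` the integral twist model `X.twistModel d`
(`QuadraticTwistIntegralModel`; a model of the quadratic twist `X^{(d)}`) satisfies:

* `isMinimal_twistModel` — **if `X` is a minimal equation then so is `X.twistModel k`**
  (Silverman *AEC* VII.1): the twist model operation by a unit is a bijection on `R`-models
  commuting with changes of variables (`twistModel_smul`, `twistModel_twistModel_neg_mul_inv`),
  so an integral model of the twist with smaller `ord Δ` would untwist to one of `X`;
* `kodairaSymbol_twistModel` — **the Kodaira symbol is unchanged** (perfect residue field;
  `kodairaSymbolOfMinimal_twistModel` on the integral minimal models);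

and, for a global curve `W / K` over a Dedekind domain `A` at a place `v` with `|k|_v ≤ 1`,
`|4k + 1|_v = 1`:

* `isMinimalAt_twistModel`, `ordMinimalDiscriminant_twistModel`, `kodairaSymbolAt_twistModel`,
  `numComponentsAt_twistModel`, `conductorExponent_twistModel` — minimality at `v` is preserved
  and `ord_v Δ_min`, the Kodaira symbol at `v` and hence Ogg's `f_v = ord_v Δ_min + 1 − m_v`
  (`DiophantineGeometry/Conductor`) are unchanged: **the conductor exponent of an elliptic curve
  is invariant under a quadratic twist unramified at `v`** (Comalada 1994, §2; Connell,
  *Elliptic Curve Handbook* §4.3; classically via `V_ℓ(E^{(d)}) = V_ℓ(E) ⊗ χ_d` with `χ_d`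
  unramified at `v`, here on the discriminant side through Tate's algorithm).

## Design

All declarations are deliberate dot-notation extensions of the Mathlib namespace
`WeierstrassCurve` (as in `DiophantineGeometry/LocalReduction`, `…/Conductor`); theorems only.

## References

* J. H. Silverman, *The Arithmetic of Elliptic Curves*, 2nd ed. (2009), VII.1 (minimal equations,
  Prop. 1.3), X.5 Cor. 5.4. [SilvermanAEC2009]
* J. H. Silverman, *Advanced Topics in the Arithmetic of Elliptic Curves*, GTM 151 (1994), IV.9.4,
  IV.10–11. [SilvermanATAEC1994]
* S. Comalada, *Twists and reduction of an elliptic curve*, J. Number Theory 49 (1994), 45–62.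
-/

noncomputable section

open IsDedekindDomain IsLocalRing Literature.NumberTheory.DiophantineGeometry
  Literature.NumberTheory.DiophantineGeometry.TateAlgorithm Literature.NumberTheory.EllipticCurves

namespace WeierstrassCurve

/-! ### Over a DVR and its fraction field -/

section DVR

variable (R : Type*) [CommRing R] [IsDomain R] [IsDiscreteValuationRing R] {K : Type*}
  [Field K] [Algebra R K] [IsFractionRing R K]

omit [IsDomain R] [IsDiscreteValuationRing R] [IsFractionRing R K] in
/-- The twist model by an `R`-integral parameter of an `R`-integral equation is `R`-integral.
[folklore] -/
theorem isIntegral_twistModel (X : WeierstrassCurve K) [hX : IsIntegral R X] (k : R) :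
    IsIntegral R (X.twistModel (algebraMap R K k)) := by
  obtain ⟨X₀, hX₀⟩ := hX.integral
  refine ⟨X₀.twistModel k, ?_⟩
  rw [hX₀, baseChange, baseChange, map_twistModel]

omit [IsDomain R] [IsDiscreteValuationRing R] in
/-- The integral model of the twist model is the twist model of the integral model (integral models
are unique, `algebraMap R K` being injective). [folklore] -/
theorem integralModel_twistModel (X : WeierstrassCurve K) [IsIntegral R X] (k : R)
    [IsIntegral R (X.twistModel (algebraMap R K k))] :
    integralModel R (X.twistModel (algebraMap R K k)) = (integralModel R X).twistModel k := by
  apply map_injective (IsFractionRing.injective R K)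
  have h := baseChange_integralModel_eq R X
  have h' := baseChange_integralModel_eq R (X.twistModel (algebraMap R K k))
  rw [baseChange] at h h'
  change (integralModel R (X.twistModel (algebraMap R K k))).map (algebraMap R K) =
    ((integralModel R X).twistModel k).map (algebraMap R K)
  rw [map_twistModel, h', h]

omit [IsDomain R] [IsDiscreteValuationRing R] [IsFractionRing R K] in
/-- `4k' + 1`-bookkeeping in `K`: for `d = 4k + 1 ∈ Rˣ` and `k' = -k d⁻¹`,
`4 k k' + k + k' = 0` in `K`. [folklore] -/
theorem twistModel_param_cancel {k : R} (hd : IsUnit (4 * k + 1)) :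
    4 * algebraMap R K k * algebraMap R K (-k * ↑hd.unit⁻¹) + algebraMap R K k +
      algebraMap R K (-k * ↑hd.unit⁻¹) = 0 := by
  have h1 : (4 * k + 1) * (↑hd.unit⁻¹ : R) = 1 := hd.mul_val_inv
  have h0 : 4 * k * (-k * ↑hd.unit⁻¹) + k + -k * ↑hd.unit⁻¹ = 0 := by
    linear_combination (-k) * h1
  have := congrArg (algebraMap R K) h0
  simpa only [map_add, map_mul, map_ofNat, map_zero] using this

/-- **Minimality is preserved by an unramified twist.** If `X / K` is a minimal Weierstrass
equation over the DVR `R` and `d = 4k + 1 ∈ Rˣ` (`k ∈ R`), then the twist model `X.twistModel k`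
is minimal. Proof: it is integral; if `C • X.twistModel k` is integral then its twist by
`d⁻¹ = 4k' + 1` is an integral model of `X`, namely `φ'C • X` with the same `u`
(`twistModel_smul`, `twistModel_twistModel`), so `|u⁻¹² Δ(X)| ≤ |Δ(X)|` by minimality of `X`, and
multiplying by `|d⁶|` gives `|Δ(C • X^{tw})| ≤ |Δ(X^{tw})|`. Silverman *AEC* VII.1 (definition of
minimality) with X.5 Cor. 5.4. [cite: SilvermanAEC2009, VII.1 Prop. 1.3] -/
theorem isMinimal_twistModel (X : WeierstrassCurve K) [hX : IsMinimal R X] {k : R}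
    (hd : IsUnit (4 * k + 1)) : IsMinimal R (X.twistModel (algebraMap R K k)) := by
  have hV : ∀ x : K, HeightOneSpectrum.valuation K (IsDiscreteValuationRing.maximalIdeal R) x ≤ 1 ↔
      x ∈ (algebraMap R K).range :=
    fun x ↦ ⟨fun h ↦ IsDiscreteValuationRing.exists_lift_of_le_one h,
      fun ⟨r, hr⟩ ↦ hr ▸ HeightOneSpectrum.valuation_le_one _ r⟩
  have hX' := hX
  rw [isMinimal_iff_of_le_one_iff hV] at hX' ⊢
  obtain ⟨hint, hmax⟩ := hX'
  refine ⟨isIntegral_twistModel R X k, fun C hC ↦ ?_⟩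
  set k' : R := -k * ↑hd.unit⁻¹ with hk'
  haveI := hC
  have hint' : IsIntegral R ((C • X.twistModel (algebraMap R K k)).twistModel (algebraMap R K k')) :=
    isIntegral_twistModel R _ k'
  have key : (C • X.twistModel (algebraMap R K k)).twistModel (algebraMap R K k') =
      VariableChange.twistMap (algebraMap R K k') C • X := by
    rw [twistModel_smul, twistModel_twistModel, twistModel_param_cancel R hd, twistModel_zero]
  rw [key] at hint'
  have hle := hmax _ hint'
  rw [variableChange_Δ, VariableChange.twistMap_u, map_mul] at hle
  rw [variableChange_Δ, twistModel_Δ, map_mul, map_mul, mul_left_comm]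
  exact mul_le_mul' le_rfl hle

/-- `4 k + 1 ≠ 0` in `K` for `d = 4k + 1 ∈ Rˣ`. [folklore] -/
theorem twistModel_unit_ne_zero {k : R} (hd : IsUnit (4 * k + 1)) :
    (4 * algebraMap R K k + 1 : K) ≠ 0 := by
  have e : (4 * algebraMap R K k + 1 : K) = algebraMap R K (4 * k + 1) := by
    simp only [map_add, map_mul, map_ofNat, map_one]
  rw [e, map_ne_zero_iff _ (IsFractionRing.injective R K)]
  exact hd.ne_zero

/-- **The Kodaira symbol is unchanged by an unramified twist** (perfect residue field): for an
elliptic `X / K` and `d = 4k + 1 ∈ Rˣ`, `(X.twistModel d).kodairaSymbol R = X.kodairaSymbol R`.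
The twist `(X.minimal R).twistModel k = φC • X.twistModel k` of the chosen minimal model is a
minimal model of the twist (`isMinimal_twistModel`), the Kodaira symbol may be read on it
(`kodairaSymbol_eq_kodairaSymbolOfMinimal_of_isMinimal`), its integral model is the twist of the
integral minimal model (`integralModel_twistModel`), and Tate's algorithm returns the same symbol
on a twist model (`kodairaSymbolOfMinimal_twistModel`). Comalada 1994, §2; Silverman *ATAEC*
IV.9.4. [cite: SilvermanATAEC1994, IV.9.4 (PDF pp. 344–346)] -/
theorem kodairaSymbol_twistModel [PerfectField (ResidueField R)] (X : WeierstrassCurve K)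
    [X.IsElliptic] {k : R} (hd : IsUnit (4 * k + 1)) :
    (X.twistModel (algebraMap R K k)).kodairaSymbol R = X.kodairaSymbol R := by
  haveI hM : IsMinimal R ((X.minimal R).twistModel (algebraMap R K k)) :=
    isMinimal_twistModel R _ hd
  have hC : (X.minimal R).twistModel (algebraMap R K k) =
      VariableChange.twistMap (algebraMap R K k) (X.exists_isMinimal R).choose •
        X.twistModel (algebraMap R K k) := by
    rw [minimal, twistModel_smul]
  have hΔ : ((X.minimal R).twistModel (algebraMap R K k)).Δ ≠ 0 := by
    rw [twistModel_Δ, minimal, variableChange_Δ]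
    exact mul_ne_zero (pow_ne_zero _ (twistModel_unit_ne_zero R hd))
      (mul_ne_zero (pow_ne_zero _ (Units.ne_zero _)) X.isUnit_Δ.ne_zero)
  rw [kodairaSymbol_eq_kodairaSymbolOfMinimal_of_isMinimal R (X.twistModel (algebraMap R K k))
      ((X.minimal R).twistModel (algebraMap R K k)) _ hC hΔ,
    integralModel_twistModel R (X.minimal R) k, kodairaSymbolOfMinimal_twistModel hd]
  rfl

/-- `ord Δ` of the integral minimal models: unchanged by an unramified twist (`Δ ↦ d⁶ Δ`,
read on the twist of the chosen minimal model). Silverman *AEC* VII.1 Prop. 1.3.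
[cite: SilvermanAEC2009, VII.1 Prop. 1.3] -/
theorem addVal_Δ_minimal_twistModel_toNat (X : WeierstrassCurve K) [X.IsElliptic] {k : R}
    (hd : IsUnit (4 * k + 1)) :
    (IsDiscreteValuationRing.addVal R
        (((X.twistModel (algebraMap R K k)).minimal R).integralModel R).Δ).toNat =
      (IsDiscreteValuationRing.addVal R ((X.minimal R).integralModel R).Δ).toNat := by
  haveI hM : IsMinimal R ((X.minimal R).twistModel (algebraMap R K k)) :=
    isMinimal_twistModel R _ hd
  have hC : (X.minimal R).twistModel (algebraMap R K k) =
      VariableChange.twistMap (algebraMap R K k) (X.exists_isMinimal R).choose •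
        X.twistModel (algebraMap R K k) := by
    rw [minimal, twistModel_smul]
  have hΔ : ((X.minimal R).twistModel (algebraMap R K k)).Δ ≠ 0 := by
    rw [twistModel_Δ, minimal, variableChange_Δ]
    exact mul_ne_zero (pow_ne_zero _ (twistModel_unit_ne_zero R hd))
      (mul_ne_zero (pow_ne_zero _ (Units.ne_zero _)) X.isUnit_Δ.ne_zero)
  rw [addVal_Δ_minimal_toNat_eq_of_isMinimal R (X.twistModel (algebraMap R K k))
      ((X.minimal R).twistModel (algebraMap R K k)) _ hC hΔ,
    integralModel_twistModel R (X.minimal R) k, addVal_Δ_twistModel_toNat hd]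

end DVR

/-! ### At a finite place of a Dedekind domain -/

section Dedekind

variable {A : Type*} [CommRing A] [IsDedekindDomain A] {K : Type*} [Field K] [Algebra A K]
  [IsFractionRing A K] (v : HeightOneSpectrum A) (W : WeierstrassCurve K) {k : K}

/-- A `v`-integral twisting parameter `k` with `|4k + 1|_v = 1` lifts to `k₀ ∈ O_v` with
`4k₀ + 1 ∈ O_vˣ`. [folklore] -/
theorem exists_adicCompletionIntegers_twist_param (hk : v.valuation K k ≤ 1)
    (hd : v.valuation K (4 * k + 1) = 1) :
    ∃ k₀ : v.adicCompletionIntegers K, IsUnit (4 * k₀ + 1) ∧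
      algebraMap (v.adicCompletionIntegers K) (v.adicCompletion K) k₀ =
        algebraMap K (v.adicCompletion K) k := by
  have hk' : Valued.v (algebraMap K (v.adicCompletion K) k) ≤ 1 := by
    rw [valued_algebraMap_adicCompletion]; exact hk
  refine ⟨⟨algebraMap K (v.adicCompletion K) k,
    (HeightOneSpectrum.mem_adicCompletionIntegers A K v).mpr hk'⟩, ?_, rfl⟩
  have hv : Valuation.Integers (Valued.v (R := v.adicCompletion K)) (v.adicCompletionIntegers K) :=
    Valuation.valuationSubring.integers _
  rw [hv.isUnit_iff_valuation_eq_one]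
  change Valued.v (4 * algebraMap K (v.adicCompletion K) k + 1) = 1
  have e : (4 * algebraMap K (v.adicCompletion K) k + 1) = algebraMap K (v.adicCompletion K) (4 * k + 1) := by
    simp only [map_add, map_mul, map_ofNat, map_one]
  rw [e, valued_algebraMap_adicCompletion, hd]

/-- The base change to `K_v` of the twist model is the twist model of the base change. [folklore] -/
theorem baseChange_twistModel_adicCompletion {k₀ : v.adicCompletionIntegers K}
    (hk₀ : algebraMap (v.adicCompletionIntegers K) (v.adicCompletion K) k₀ =
      algebraMap K (v.adicCompletion K) k) :
    (W.twistModel k).baseChange (v.adicCompletion K) =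
      (W.baseChange (v.adicCompletion K)).twistModel
        (algebraMap (v.adicCompletionIntegers K) (v.adicCompletion K) k₀) := by
  rw [hk₀, baseChange, baseChange, map_twistModel]

/-- **Minimality at `v` is preserved by a twist unramified at `v`**: if `W` is minimal at `v`,
`|k|_v ≤ 1` and `|4k + 1|_v = 1` then `W.twistModel k` is minimal at `v`
(`isMinimal_twistModel` over `O_v`). Silverman *AEC* VII.1. [cite: SilvermanAEC2009, VII.1 Prop. 1.3] -/
theorem isMinimalAt_twistModel (hW : W.IsMinimalAt v) (hk : v.valuation K k ≤ 1)
    (hd : v.valuation K (4 * k + 1) = 1) : (W.twistModel k).IsMinimalAt v := by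
  obtain ⟨k₀, hu, hk₀⟩ := exists_adicCompletionIntegers_twist_param v hk hd
  haveI : (W.baseChange (v.adicCompletion K)).IsMinimal (v.adicCompletionIntegers K) := hW
  unfold IsMinimalAt
  rw [baseChange_twistModel_adicCompletion v W hk₀]
  exact isMinimal_twistModel _ _ hu

/-- **The Kodaira symbol at `v` is unchanged by a twist unramified at `v`** (elliptic `W`,
perfect residue field at `v`). Comalada 1994, §2; Silverman *ATAEC* IV.9.4.
[cite: SilvermanATAEC1994, IV.9.4 (PDF pp. 344–346)] -/
theorem kodairaSymbolAt_twistModel [W.IsElliptic]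
    [PerfectField (ResidueField (v.adicCompletionIntegers K))] (hk : v.valuation K k ≤ 1)
    (hd : v.valuation K (4 * k + 1) = 1) : (W.twistModel k).kodairaSymbolAt v = W.kodairaSymbolAt v := by
  obtain ⟨k₀, hu, hk₀⟩ := exists_adicCompletionIntegers_twist_param v hk hd
  haveI : (W.baseChange (v.adicCompletion K)).IsElliptic := by
    unfold baseChange; infer_instance
  unfold kodairaSymbolAt
  rw [baseChange_twistModel_adicCompletion v W hk₀]
  exact kodairaSymbol_twistModel _ _ hu

/-- The number of components `m_v` is unchanged by a twist unramified at `v`. [folklore] -/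
theorem numComponentsAt_twistModel [W.IsElliptic]
    [PerfectField (ResidueField (v.adicCompletionIntegers K))] (hk : v.valuation K k ≤ 1)
    (hd : v.valuation K (4 * k + 1) = 1) :
    (W.twistModel k).numComponentsAt v = W.numComponentsAt v := by
  rw [numComponentsAt, numComponentsAt, kodairaSymbolAt_twistModel v W hk hd]

/-- **`ord_v Δ_min` is unchanged by a twist unramified at `v`** (elliptic `W`): the twist of a
minimal model at `v` is a minimal model of the twist and `Δ ↦ d⁶ Δ` with `d` a `v`-unit.
Silverman *AEC* VII.1 Prop. 1.3. [cite: SilvermanAEC2009, VII.1 Prop. 1.3] -/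
theorem ordMinimalDiscriminant_twistModel [W.IsElliptic] (hk : v.valuation K k ≤ 1)
    (hd : v.valuation K (4 * k + 1) = 1) :
    (W.twistModel k).ordMinimalDiscriminant v = W.ordMinimalDiscriminant v := by
  obtain ⟨k₀, hu, hk₀⟩ := exists_adicCompletionIntegers_twist_param v hk hd
  haveI : (W.baseChange (v.adicCompletion K)).IsElliptic := by
    unfold baseChange; infer_instance
  haveI hM : IsMinimal (v.adicCompletionIntegers K)
      (((W.baseChange (v.adicCompletion K)).minimal (v.adicCompletionIntegers K)).twistModel
        (algebraMap (v.adicCompletionIntegers K) (v.adicCompletion K) k₀)) :=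
    isMinimal_twistModel (v.adicCompletionIntegers K) _ hu
  have hC : ((W.baseChange (v.adicCompletion K)).minimal (v.adicCompletionIntegers K)).twistModel
        (algebraMap (v.adicCompletionIntegers K) (v.adicCompletion K) k₀) =
      VariableChange.twistMap (algebraMap (v.adicCompletionIntegers K) (v.adicCompletion K) k₀)
          ((W.baseChange (v.adicCompletion K)).exists_isMinimal (v.adicCompletionIntegers K)).choose •
        (W.twistModel k).baseChange (v.adicCompletion K) := by
    rw [baseChange_twistModel_adicCompletion v W hk₀, minimal, twistModel_smul]
  have hΔ : (((W.baseChange (v.adicCompletion K)).minimal (v.adicCompletionIntegers K)).twistModel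
      (algebraMap (v.adicCompletionIntegers K) (v.adicCompletion K) k₀)).Δ ≠ 0 := by
    rw [twistModel_Δ, minimal, variableChange_Δ]
    exact mul_ne_zero (pow_ne_zero _ (twistModel_unit_ne_zero _ hu))
      (mul_ne_zero (pow_ne_zero _ (Units.ne_zero _))
        (W.baseChange (v.adicCompletion K)).isUnit_Δ.ne_zero)
  rw [ordMinimalDiscriminant_eq_of_isMinimal v (W.twistModel k) _ _ hC hΔ,
    integralModel_twistModel (v.adicCompletionIntegers K)
      ((W.baseChange (v.adicCompletion K)).minimal (v.adicCompletionIntegers K)) k₀,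
    addVal_Δ_twistModel_toNat hu]
  rfl

/-- **The conductor exponent is unchanged by a twist unramified at `v`**: for an elliptic `W / K`,
a place `v` with perfect residue field, and `k` with `|k|_v ≤ 1`, `|4k + 1|_v = 1`, Ogg's
`f_v = ord_v Δ_min + 1 − m_v` (`WeierstrassCurve.conductorExponent`) takes the same value on the
twist model `W.twistModel k` (a model of `E^{(4k+1)}`) as on `W`. This is the prime-by-prime
content of `N(E^{(d)}) = N(E) d²` at the primes not dividing `d` (Connell, *Elliptic Curve
Handbook* §4.3; Comalada 1994, §2). [cite: SilvermanATAEC1994, IV.9.4 (PDF pp. 344–346)] -/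
theorem conductorExponent_twistModel [W.IsElliptic]
    [PerfectField (ResidueField (v.adicCompletionIntegers K))] (hk : v.valuation K k ≤ 1)
    (hd : v.valuation K (4 * k + 1) = 1) :
    (W.twistModel k).conductorExponent v = W.conductorExponent v := by
  rw [conductorExponent, conductorExponent, ordMinimalDiscriminant_twistModel v W hk hd,
    numComponentsAt_twistModel v W hk hd]

end Dedekind

end WeierstrassCurve

end
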